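import Mathlib.Analysis.MellinTransform
import Mathlib.NumberTheory.LSeries.RiemannZeta
import Literature.NumberTheory.LFunctions.ConnesProlateGuessTail
import Literature.NumberTheory.LFunctions.ProlateParity
import Literature.NumberTheory.LFunctions.RiemannXiMellinGaussian
import Literature.NumberTheory.LFunctions.MellinVanishingIntegral
import Literature.NumberTheory.LFunctions.MellinIntegrationByParts
import Literature.NumberTheory.LFunctions.ZetaFractionalPartIntegral
import Mathlib.Analysis.SpecialFunctions.Gaussian.GaussianIntegral
import HarnessLib

/-!
# The error term in Connes' Fact 6.4: `4M_λ(s) − ξ(½+s) = 4ζ(½+s)·(𝓜h_λ − 𝓜h)(s+½) − 4B_λ(s)`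

Connes 2026 (Letter), Fact 6.4, asserts that `4M_λ(s) → ξ(½+s)` uniformly on closed substrips of
`|Re s| < ½`, where `M_λ(s) = ∫_{1/λ}^{λ} 𝓔(h_λ)(u)u^{s-1}du` is the truncated Mellin transform of the
prolate guess (`prolateGuessMellin`; the tree's `prolateGuess_tendsto_riemannXi` is the statement, kept
as a named fact).  Combining

* the truncation identity `M_λ(s) = ζ(½+s)𝓜h_λ(s+½) − B_λ(s)`, `B_λ(s) = ∫_0^{1/λ}𝓔(h_λ)(u)u^{s-1}du`
  (`prolateGuessMellin_eq`, file `ConnesProlateGuessTail.lean`, from Müntz's formula in the strip), and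
* Riemann's identity `ξ(w) = 4ζ(w)𝓜h(w)` for `h(x) = (π²x⁴ − (3/2)πx²)e^{−πx²}`
  (`riemannXi_eq_four_mul_zeta_mul_mellin`, file `RiemannXiMellinGaussian.lean`; CCM25 Lemma 7.1),

gives, sorry-free, the exact decomposition of the error for `−½ < Re s`, `s ≠ ½`:

  **(★)** `4M_λ(s) − ξ(½+s) = 4ζ(s+½)·(𝓜h_λ(s+½) − 𝓜h(s+½)) − 4B_λ(s)`
  (`four_mul_prolateGuessMellin_sub_riemannXi`),

together with the crude boundary bound `‖4B_λ(s)‖ ≤ 4(V_λ + M)λ^{-(σ+½)}/(σ+½)` (`V_λ` the total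
variation and `M` a bound of `h_λ` on `[0,λ]`, `σ = Re s`), whence
`‖4M_λ(s) − ξ(½+s)‖ ≤ 4‖ζ(s+½)‖·‖𝓜h_λ(s+½) − 𝓜h(s+½)‖ + 4(V_λ+M)λ^{-(σ+½)}/(σ+½)`
(`norm_four_mul_prolateGuessMellin_sub_riemannXi_le_of_bv`).  Near the pole `w = s+½ = 1` of `ζ`
(`s = ½` lies outside the Letter's strip but inside the half-plane `Re s > −½` where (★) holds) the main
term stays bounded thanks to the vanishing integrals `∫_0^∞ h_λ = ∫_0^∞ h = 0`
(`integral_ofReal_connesHermiteH_Ioi`; file `MellinVanishingIntegral.lean`):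
`‖ζ(s+½)(𝓜h_λ − 𝓜h)(s+½)‖ ≤ |(s−½)ζ(s+½)| · ∫_0^∞ |log x|·max(1, x^{σ−½})·|h_λ(x) − h(x)| dx`
(`norm_zeta_mul_mellin_prolateGuessH_sub_le`), whence (`norm_four_mul_prolateGuessMellin_sub_riemannXi_le`):
for `−½ < σ = Re s`, `s ≠ ½`,

  `‖4M_λ(s) − ξ(½+s)‖ ≤ 4|(s−½)ζ(s+½)| ∫_0^∞ |log x| max(1,x^{σ−½}) |h_λ − h|(x) dx + 4(V_λ+M)λ^{-(σ+½)}/(σ+½)`.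

On the Letter's strip `|Re s| ≤ α₀ < ½` the condition `s ≠ ½` is automatic, and `(s−½)ζ(s+½)` is
continuous there, hence bounded on every bounded-height part `|Im s| ≤ T` — but NOT uniformly in
`Im s` (it is unbounded, of polynomial growth in `|Im s|`), whereas Fact 6.4 is a supremum over the
whole strip.
Uniformity in `Im s` is obtained by ONE MELLIN INTEGRATION BY PARTS (file `MellinIntegrationByParts.lean`):
`ζ(w)(𝓜h_λ − 𝓜h)(w) = (ζ(w)/w)·(h_λ(λ)λ^w − ∫_0^λ (h_λ′ − h′)(x)x^w dx + ∫_λ^∞ h′(x)x^w dx)`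
(`mul_mellin_prolateGuessH_sub_eq`), so that, with `w = s+½`, `σ' = σ+½ ∈ (0,1)`
(`norm_four_mul_prolateGuessMellin_sub_riemannXi_le_of_deriv`, the **key unconditional estimate**):

  `‖4M_λ(s) − ξ(½+s)‖ ≤ 4‖ζ(w)/w‖·(|h_λ(λ)|λ^{σ'} + ∫_0^λ |h_λ′ − h′| x^{σ'} dx + ∫_λ^∞ |h′| x^{σ'} dx)
                      + 4(V_λ+M)λ^{-σ'}/σ'`.

Here `ζ(w)/w` IS bounded on the strip uniformly in `Im w`: by Titchmarsh (2.12.2) in the tree's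
explicit form (`norm_riemannZeta_le_of_re_pos`, file `ZetaFractionalPartIntegral.lean`, from
`ζ(w) = w/(w−1) − w∫_1^∞ {x}x^{-w-1}dx`), `‖ζ(w)/w‖ ≤ 1/‖w−1‖ + 1/Re w ≤ 1/(½−σ) + 1/(½+σ)` for
`|σ| < ½` (`norm_riemannZeta_div_le_of_abs_re_lt`); and `∫_λ^∞|h′|x^{σ'}` is an explicit Gaussian tail.
The resulting **fully explicit, `Im s`-free bound** is `norm_four_mul_prolateGuessMellin_sub_riemannXi_le_explicit`:
for `|Re s| < ½`,

  `‖4M_λ(s) − ξ(½+s)‖ ≤ 4(1/(½−σ) + 1/(½+σ))·(|h_λ(λ)|λ^{σ+½} + ∫_0^λ |h_λ′ − h′| x^{σ+½} dx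
                          + ∫_λ^∞ |h′| x^{σ+½} dx) + 4(V_λ+M)λ^{-(σ+½)}/(σ+½)`.

Finally `norm_four_mul_prolateGuessMellin_sub_riemannXi_le_uniform` removes `s` altogether: for `λ ≥ 1`,
`0 ≤ α₀ < ½` and every `s` with `|Re s| ≤ α₀`,

  `‖4M_λ(s) − ξ(½+s)‖ ≤ R(λ, α₀) := (4/(¼−α₀²))·(|h_λ(λ)|λ + ∫_0^λ |h_λ′ − h′|(x)(x^{½−α₀} + x^{½+α₀})dx
                          + ∫_λ^∞ |h′(x)|(x^{½−α₀} + x^{½+α₀})dx) + 4(V_λ+M)λ^{-(½−α₀)}/(½−α₀)`.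

So Fact 6.4 exactly as printed (supremum over the closed substrip `|Re s| ≤ α₀ < ½`) is the
consequence of `R(λ, α₀) → 0`, i.e. of statements of prolate asymptotics which are NOT proved here and
are the whole difficulty: `(V_λ + M_λ)λ^{-(½−α₀)} → 0` (e.g. `V_λ, M_λ = O(1)`), `λ·h_λ(λ) → 0`, and
`∫_0^λ |h_λ′ − h′|(x)(x^{½-α₀} + x^{½+α₀})dx → 0` (a weighted `W^{1,1}` convergence `h_λ → h`; the
`h′`-tail is a Gaussian tail and `→ 0`, `tendsto_integral_Ioi_abs_connesHermiteH'_atTop`).  The last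
theorem, `norm_four_mul_prolateGuessMellin_sub_riemannXi_le_W11`, puts the boundary term in `W^{1,1}` form
as well (`V_0^λ(h_λ) ≤ ∫_0^λ |h_λ′|`, `sup |h_λ| ≤ |h_λ(λ)| + ∫_0^λ |h_λ′|`, evenness being the theorem
`IsProlateFunction.even` of `ProlateParity.lean`), so that its only hypotheses are `IsProlateFunction λ 0
h_{0,λ}`, `IsProlateFunction λ 4 h_{4,λ}`, `λ ≥ 1`, `0 ≤ α₀ < ½`, `|Re s| ≤ α₀`: Fact 6.4 is thereby reduced,
inside the tree, to `λ h_λ(λ) → 0` and the plain and weighted `L¹[0, λ]` convergence `h_λ′ → h′`.  Nothing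
in this file uses or approaches RH.
-/

open Real Complex Set MeasureTheory Filter Topology Asymptotics intervalIntegral

open scoped NNReal ENNReal

namespace Literature.NumberTheory.LFunctions

/-- The lowest prolate function has positive integral: `h_{0,λ}` has no zero in `(−λ, λ)` and
`h_{0,λ}(0) > 0`, hence `h_{0,λ} > 0` on `(−λ, λ)` and `∫_{−λ}^{λ} h_{0,λ} > 0`.  (This discharges the
hypothesis `∫ h_{0,λ} ≠ 0` under which `prolateGuessH` is the vanishing-integral combination.)
[cite: Connes2026Letter, §6.4] -/
theorem integral_pos_of_isProlateFunction_zero {lam : ℝ} {f0 : ℝ → ℝ}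
    (h0 : IsProlateFunction lam 0 f0) : 0 < ∫ y in (-lam)..lam, f0 y := by
  have hlam : 0 < lam := h0.lam_pos
  have hempty : {x : ℝ | x ∈ Ioo (-lam) lam ∧ f0 x = 0} = ∅ :=
    (Set.ncard_eq_zero h0.zeros_finite).mp h0.zeros_card
  have hne : ∀ x ∈ Ioo (-lam) lam, f0 x ≠ 0 := by
    intro x hx hfx
    have hmem : x ∈ {x : ℝ | x ∈ Ioo (-lam) lam ∧ f0 x = 0} := ⟨hx, hfx⟩
    rw [hempty] at hmem
    exact hmem
  have hcont : ContinuousOn f0 (Icc (-lam) lam) := h0.contDiffOn.continuousOn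
  have h0mem : (0 : ℝ) ∈ Ioo (-lam) lam := ⟨by linarith, hlam⟩
  have hpos : ∀ x ∈ Ioo (-lam) lam, 0 < f0 x := by
    intro x hx
    by_contra hle
    rw [not_lt] at hle
    have hsub := isPreconnected_Ioo.intermediate_value hx h0mem (hcont.mono Ioo_subset_Icc_self)
    obtain ⟨z, hz, hz0⟩ := hsub ⟨hle, h0.pos_zero.le⟩
    exact hne z hz hz0
  refine intervalIntegral.intervalIntegral_pos_of_pos_on ?_ hpos (by linarith)
  exact (hcont.mono (by rw [Set.uIcc_of_le (by linarith)])).intervalIntegrable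

/-- **(★) The error in Fact 6.4, exactly.**  For prolate functions `h_{0,λ}, h_{4,λ}`, the guess
`h_λ = prolateGuessH λ h_{0,λ} h_{4,λ}` with `∫_0^λ h_λ = 0`, and `−½ < Re s`, `s ≠ ½`:
`4·M_λ(s) − ξ(½+s) = 4ζ(s+½)(𝓜h_λ(s+½) − 𝓜h(s+½)) − 4∫_{(0,1/λ]} 𝓔(h_λ)(u)u^{s-1}du`.
[cite: ConnesConsaniMoscovici2025, §7 Lemma 7.1 and proof of Lemma 7.3] -/
theorem four_mul_prolateGuessMellin_sub_riemannXi {lam : ℝ} {f0 f4 : ℝ → ℝ}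
    (h0 : IsProlateFunction lam 0 f0) (h4 : IsProlateFunction lam 4 f4)
    (hint : ∫ t in (0 : ℝ)..lam, prolateGuessH lam f0 f4 t = 0)
    {s : ℂ} (hs : -(1 / 2 : ℝ) < s.re) (hs1 : s ≠ 1 / 2) :
    4 * prolateGuessMellin lam f0 f4 s - riemannXi (1 / 2 + s) =
      4 * riemannZeta (s + 1 / 2) *
          (mellin (fun x ↦ (prolateGuessH lam f0 f4 x : ℂ)) (s + 1 / 2)
            - mellin (fun x ↦ (connesHermiteH x : ℂ)) (s + 1 / 2))
        - 4 * ∫ u in Ioc 0 (1 / lam), (connesE (prolateGuessH lam f0 f4) u : ℂ) * (u : ℂ) ^ (s - 1) := by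
  have hw : 0 < (s + 1 / 2).re := by
    simp only [add_re, one_div]
    norm_num
    linarith
  have hw1 : s + 1 / 2 ≠ 1 := by
    intro h
    apply hs1
    linear_combination h
  rw [prolateGuessMellin_eq h0 h4 hint hs hs1, show (1 : ℂ) / 2 + s = s + 1 / 2 by ring,
    riemannXi_eq_four_mul_zeta_mul_mellin hw hw1]
  ring

/-- (★) with `∫_0^λ h_λ = 0` discharged: prolate functions are even (`IsProlateFunction.even`,
file `ProlateParity.lean`) and `∫ h_{0,λ} > 0` (`integral_pos_of_isProlateFunction_zero`).
[cite: Connes2026Letter, §6.3–6.4] -/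
theorem four_mul_prolateGuessMellin_sub_riemannXi_of_even {lam : ℝ} {f0 f4 : ℝ → ℝ}
    (h0 : IsProlateFunction lam 0 f0) (h4 : IsProlateFunction lam 4 f4)
    {s : ℂ} (hs : -(1 / 2 : ℝ) < s.re) (hs1 : s ≠ 1 / 2) :
    4 * prolateGuessMellin lam f0 f4 s - riemannXi (1 / 2 + s) =
      4 * riemannZeta (s + 1 / 2) *
          (mellin (fun x ↦ (prolateGuessH lam f0 f4 x : ℂ)) (s + 1 / 2)
            - mellin (fun x ↦ (connesHermiteH x : ℂ)) (s + 1 / 2))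
        - 4 * ∫ u in Ioc 0 (1 / lam), (connesE (prolateGuessH lam f0 f4) u : ℂ) * (u : ℂ) ^ (s - 1) :=
  four_mul_prolateGuessMellin_sub_riemannXi h0 h4
    (integral_zero_lam_prolateGuessH_eq_zero h0 h4 h0.even h4.even
      (integral_pos_of_isProlateFunction_zero h0).ne') hs hs1

/-- **The error in Fact 6.4 up to the boundary piece.**  With `V_λ = TV(h_λ;[0,λ])`, `M` a bound of
`|h_λ|` on `[0,λ]`, `∫_0^λ h_λ = 0`, `σ = Re s > −½`, `s ≠ ½`:
`‖(4M_λ(s) − ξ(½+s)) − 4ζ(s+½)(𝓜h_λ(s+½) − 𝓜h(s+½))‖ ≤ 4(V_λ + M)λ^{-(σ+½)}/(σ+½)`.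
[cite: ConnesConsaniMoscovici2025, §7 proof of Lemma 7.3] -/
theorem norm_four_mul_prolateGuessMellin_sub_riemannXi_sub_le_of_bv {lam : ℝ} {f0 f4 : ℝ → ℝ}
    (h0 : IsProlateFunction lam 0 f0) (h4 : IsProlateFunction lam 4 f4)
    (hint : ∫ t in (0 : ℝ)..lam, prolateGuessH lam f0 f4 t = 0)
    {M : ℝ} (hM : ∀ t ∈ Icc 0 lam, |prolateGuessH lam f0 f4 t| ≤ M)
    {s : ℂ} (hs : -(1 / 2 : ℝ) < s.re) (hs1 : s ≠ 1 / 2) :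
    ‖(4 * prolateGuessMellin lam f0 f4 s - riemannXi (1 / 2 + s))
        - 4 * riemannZeta (s + 1 / 2) *
          (mellin (fun x ↦ (prolateGuessH lam f0 f4 x : ℂ)) (s + 1 / 2)
            - mellin (fun x ↦ (connesHermiteH x : ℂ)) (s + 1 / 2))‖ ≤
      4 * (((eVariationOn (prolateGuessH lam f0 f4) (Icc 0 lam)).toReal + M)
        * lam ^ (-(s.re + 1 / 2)) / (s.re + 1 / 2)) := by
  have hw : 0 < (s + 1 / 2).re := by
    simp only [add_re, one_div]
    norm_num
    linarith
  have hw1 : s + 1 / 2 ≠ 1 := by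
    intro h
    apply hs1
    linear_combination h
  have key : (4 * prolateGuessMellin lam f0 f4 s - riemannXi (1 / 2 + s))
      - 4 * riemannZeta (s + 1 / 2) *
          (mellin (fun x ↦ (prolateGuessH lam f0 f4 x : ℂ)) (s + 1 / 2)
            - mellin (fun x ↦ (connesHermiteH x : ℂ)) (s + 1 / 2))
      = 4 * (prolateGuessMellin lam f0 f4 s
          - riemannZeta (s + 1 / 2) * mellin (fun x ↦ (prolateGuessH lam f0 f4 x : ℂ)) (s + 1 / 2)) := by
    rw [show (1 : ℂ) / 2 + s = s + 1 / 2 by ring, riemannXi_eq_four_mul_zeta_mul_mellin hw hw1]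
    ring
  rw [key, norm_mul]
  have h4n : ‖(4 : ℂ)‖ = 4 := by simp
  rw [h4n]
  exact mul_le_mul_of_nonneg_left (norm_prolateGuessMellin_sub_le_of_bv h0 h4 hint hM hs hs1)
    (by norm_num)

/-- **Fact 6.4 reduced to its main term (crude boundary bound).**  Under the same hypotheses:
`‖4M_λ(s) − ξ(½+s)‖ ≤ 4‖ζ(s+½)‖·‖𝓜h_λ(s+½) − 𝓜h(s+½)‖ + 4(V_λ + M)λ^{-(σ+½)}/(σ+½)`.
The two inputs Fact 6.4 then needs — `V_λ, M = O(1)` and `ζ(s+½)(𝓜h_λ − 𝓜h)(s+½) → 0` uniformly on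
`|Re s| ≤ α₀ < ½` — are prolate asymptotics and are not proved in the tree.
[cite: Connes2026Letter, §6.4 Fact 6.4] -/
theorem norm_four_mul_prolateGuessMellin_sub_riemannXi_le_of_bv {lam : ℝ} {f0 f4 : ℝ → ℝ}
    (h0 : IsProlateFunction lam 0 f0) (h4 : IsProlateFunction lam 4 f4)
    (hint : ∫ t in (0 : ℝ)..lam, prolateGuessH lam f0 f4 t = 0)
    {M : ℝ} (hM : ∀ t ∈ Icc 0 lam, |prolateGuessH lam f0 f4 t| ≤ M)
    {s : ℂ} (hs : -(1 / 2 : ℝ) < s.re) (hs1 : s ≠ 1 / 2) :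
    ‖4 * prolateGuessMellin lam f0 f4 s - riemannXi (1 / 2 + s)‖ ≤
      4 * ‖riemannZeta (s + 1 / 2)‖ *
          ‖mellin (fun x ↦ (prolateGuessH lam f0 f4 x : ℂ)) (s + 1 / 2)
            - mellin (fun x ↦ (connesHermiteH x : ℂ)) (s + 1 / 2)‖
        + 4 * (((eVariationOn (prolateGuessH lam f0 f4) (Icc 0 lam)).toReal + M)
          * lam ^ (-(s.re + 1 / 2)) / (s.re + 1 / 2)) := by
  set D := 4 * prolateGuessMellin lam f0 f4 s - riemannXi (1 / 2 + s) with hD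
  set Z := 4 * riemannZeta (s + 1 / 2) *
      (mellin (fun x ↦ (prolateGuessH lam f0 f4 x : ℂ)) (s + 1 / 2)
        - mellin (fun x ↦ (connesHermiteH x : ℂ)) (s + 1 / 2)) with hZ
  have hB := norm_four_mul_prolateGuessMellin_sub_riemannXi_sub_le_of_bv h0 h4 hint hM hs hs1
  rw [← hD, ← hZ] at hB
  have hZn : ‖Z‖ = 4 * ‖riemannZeta (s + 1 / 2)‖ *
      ‖mellin (fun x ↦ (prolateGuessH lam f0 f4 x : ℂ)) (s + 1 / 2)
        - mellin (fun x ↦ (connesHermiteH x : ℂ)) (s + 1 / 2)‖ := by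
    rw [hZ, norm_mul, norm_mul]
    simp
  calc ‖D‖ = ‖Z + (D - Z)‖ := by rw [add_sub_cancel]
    _ ≤ ‖Z‖ + ‖D - Z‖ := norm_add_le _ _
    _ ≤ _ := by rw [hZn]; exact add_le_add le_rfl hB

/-- The same with `∫_0^λ h_λ = 0` discharged (prolate functions are even, `IsProlateFunction.even`).
[cite: Connes2026Letter, §6.4 Fact 6.4] -/
theorem norm_four_mul_prolateGuessMellin_sub_riemannXi_le_of_bv_of_even {lam : ℝ} {f0 f4 : ℝ → ℝ}
    (h0 : IsProlateFunction lam 0 f0) (h4 : IsProlateFunction lam 4 f4)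
    {M : ℝ} (hM : ∀ t ∈ Icc 0 lam, |prolateGuessH lam f0 f4 t| ≤ M)
    {s : ℂ} (hs : -(1 / 2 : ℝ) < s.re) (hs1 : s ≠ 1 / 2) :
    ‖4 * prolateGuessMellin lam f0 f4 s - riemannXi (1 / 2 + s)‖ ≤
      4 * ‖riemannZeta (s + 1 / 2)‖ *
          ‖mellin (fun x ↦ (prolateGuessH lam f0 f4 x : ℂ)) (s + 1 / 2)
            - mellin (fun x ↦ (connesHermiteH x : ℂ)) (s + 1 / 2)‖
        + 4 * (((eVariationOn (prolateGuessH lam f0 f4) (Icc 0 lam)).toReal + M)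
          * lam ^ (-(s.re + 1 / 2)) / (s.re + 1 / 2)) :=
  norm_four_mul_prolateGuessMellin_sub_riemannXi_le_of_bv h0 h4
    (integral_zero_lam_prolateGuessH_eq_zero h0 h4 h0.even h4.even
      (integral_pos_of_isProlateFunction_zero h0).ne') hM hs hs1

/-! ### The main term across the pole `s = ½` -/

/-- `𝓜h(1) = 0`, i.e. `∫_0^∞ h = 0` in Mellin form (`Γ_ℝ(1)·1·0/8 = 0`).
[cite: ConnesConsaniMoscovici2025, §7 Lemma 7.1] -/
theorem mellin_connesHermiteH_one : mellin (fun x ↦ (connesHermiteH x : ℂ)) 1 = 0 := by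
  rw [mellin_connesHermiteH (show (0 : ℝ) < (1 : ℂ).re by simp)]
  simp

/-- **`∫_0^∞ h(x) dx = 0`** — the Hermite combination `h = (√3/2^{11/4})h_4 − (3/2^{17/4})h_0` is "the only
linear combination of `h_0, h_4` with vanishing integral" (as a complex integral over `(0,∞)`).
[cite: ConnesConsaniMoscovici2025, §7 Lemma 7.1] -/
theorem integral_ofReal_connesHermiteH_Ioi : ∫ x in Ioi (0 : ℝ), (connesHermiteH x : ℂ) = 0 := by
  rw [← mellin_connesHermiteH_one, mellin]
  refine setIntegral_congr_fun measurableSet_Ioi fun x _ ↦ ?_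
  simp

/-- `h` is integrable on `(0, ∞)` (as a complex-valued function). [folklore] -/
theorem integrableOn_ofReal_connesHermiteH_Ioi :
    IntegrableOn (fun x ↦ (connesHermiteH x : ℂ)) (Ioi 0) := by
  have h := mellinConvergent_connesHermiteH (show (0 : ℝ) < (1 : ℂ).re by simp)
  rw [MellinConvergent] at h
  refine h.congr_fun (fun x _ ↦ ?_) measurableSet_Ioi
  simp

/-- `∫_0^∞ h_λ = 0` over `(0, ∞)` (complex form) from `∫_0^λ h_λ = 0` and the support of `h_λ`.
[cite: Connes2026Letter, §6.4] -/
theorem integral_ofReal_prolateGuessH_Ioi {lam : ℝ} {f0 f4 : ℝ → ℝ}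
    (h0 : IsProlateFunction lam 0 f0) (h4 : IsProlateFunction lam 4 f4)
    (hint : ∫ t in (0 : ℝ)..lam, prolateGuessH lam f0 f4 t = 0) :
    ∫ x in Ioi (0 : ℝ), (prolateGuessH lam f0 f4 x : ℂ) = 0 := by
  have hlam : 0 < lam := h0.lam_pos
  obtain ⟨-, hsupp⟩ := prolateGuessH_lipschitz_support h0 h4
  have hzero : ∀ x ∈ Ioi (0 : ℝ) \ Ioc 0 lam, (prolateGuessH lam f0 f4 x : ℂ) = 0 := by
    intro x hx
    have hxl : lam < x := by
      by_contra h
      exact hx.2 ⟨hx.1, not_lt.mp h⟩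
    simp [hsupp x hxl]
  rw [setIntegral_eq_of_subset_of_forall_sdiff_eq_zero measurableSet_Ioi Ioc_subset_Ioi_self hzero,
    ← intervalIntegral.integral_of_le hlam.le, intervalIntegral.integral_ofReal, hint, Complex.ofReal_zero]

/-- **The main term of (★) across the pole.**  For prolate data with `∫_0^λ h_λ = 0` and `σ = Re s > −½`
(no condition `s ≠ ½`), provided `|log x|·max(1,x^{σ−½})·|h_λ(x) − h(x)|` is integrable on `(0,∞)`:
`‖ζ(s+½)·(𝓜h_λ(s+½) − 𝓜h(s+½))‖ ≤ |(s−½)ζ(s+½)| · ∫_0^∞ |log x| max(1, x^{σ−½}) |h_λ(x) − h(x)| dx`.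
(The zero of `𝓜(h_λ − h)` at `s = ½`, forced by `∫(h_λ − h) = 0`, cancels the pole of `ζ`.)
[cite: Connes2026Letter, §6.4 Fact 6.4] -/
theorem norm_zeta_mul_mellin_prolateGuessH_sub_le {lam : ℝ} {f0 f4 : ℝ → ℝ}
    (h0 : IsProlateFunction lam 0 f0) (h4 : IsProlateFunction lam 4 f4)
    (hint : ∫ t in (0 : ℝ)..lam, prolateGuessH lam f0 f4 t = 0) {s : ℂ} (hs : -(1 / 2 : ℝ) < s.re)
    (hW : IntegrableOn (fun x : ℝ ↦ |Real.log x| * max 1 (x ^ (s.re - 1 / 2))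
      * |prolateGuessH lam f0 f4 x - connesHermiteH x|) (Ioi 0)) :
    ‖riemannZeta (s + 1 / 2) *
        (mellin (fun x ↦ (prolateGuessH lam f0 f4 x : ℂ)) (s + 1 / 2)
          - mellin (fun x ↦ (connesHermiteH x : ℂ)) (s + 1 / 2))‖ ≤
      ‖(s - 1 / 2) * riemannZeta (s + 1 / 2)‖ *
        ∫ x in Ioi 0, |Real.log x| * max 1 (x ^ (s.re - 1 / 2))
          * |prolateGuessH lam f0 f4 x - connesHermiteH x| := by
  have hlam : 0 < lam := h0.lam_pos
  have hw : 0 < (s + 1 / 2).re := by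
    simp only [add_re, one_div]
    norm_num
    linarith
  have hwre : (s + 1 / 2).re - 1 = s.re - 1 / 2 := by
    simp only [add_re, one_div]
    norm_num
    ring
  set g : ℝ → ℂ := fun x ↦ ((prolateGuessH lam f0 f4 x - connesHermiteH x : ℝ) : ℂ) with hg
  obtain ⟨⟨L, hL⟩, hsupp⟩ := prolateGuessH_lipschitz_support h0 h4
  -- Mellin convergence at `s + ½`
  have hcl : MellinConvergent (fun x ↦ (prolateGuessH lam f0 f4 x : ℂ)) (s + 1 / 2) :=
    mellinConvergent_ofReal_of_continuousOn hlam hL.continuousOn hsupp hw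
  have hch : MellinConvergent (fun x ↦ (connesHermiteH x : ℂ)) (s + 1 / 2) :=
    mellinConvergent_connesHermiteH hw
  have hptw : ∀ x : ℝ, (x : ℂ) ^ (s + 1 / 2 - 1) • g x =
      (x : ℂ) ^ (s + 1 / 2 - 1) • (prolateGuessH lam f0 f4 x : ℂ)
        - (x : ℂ) ^ (s + 1 / 2 - 1) • (connesHermiteH x : ℂ) := fun x ↦ by
    simp only [hg, Complex.ofReal_sub, smul_sub]
  have hgc : MellinConvergent g (s + 1 / 2) := by
    rw [MellinConvergent] at hcl hch ⊢
    exact (hcl.sub hch).congr_fun (fun x _ ↦ (hptw x).symm) measurableSet_Ioi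
  have hmel : mellin g (s + 1 / 2) =
      mellin (fun x ↦ (prolateGuessH lam f0 f4 x : ℂ)) (s + 1 / 2)
        - mellin (fun x ↦ (connesHermiteH x : ℂ)) (s + 1 / 2) := by
    simp only [mellin]
    rw [← integral_sub hcl hch]
    exact setIntegral_congr_fun measurableSet_Ioi fun x _ ↦ hptw x
  -- integrability and vanishing integral on `(0, ∞)`
  have h1l : IntegrableOn (fun x ↦ (prolateGuessH lam f0 f4 x : ℂ)) (Ioi 0) := by
    have h := mellinConvergent_ofReal_of_continuousOn hlam hL.continuousOn hsupp
      (show (0 : ℝ) < (1 : ℂ).re by simp)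
    rw [MellinConvergent] at h
    refine h.congr_fun (fun x _ ↦ ?_) measurableSet_Ioi
    simp
  have hgi : IntegrableOn g (Ioi 0) := by
    refine (h1l.sub integrableOn_ofReal_connesHermiteH_Ioi).congr_fun (fun x _ ↦ ?_) measurableSet_Ioi
    simp only [hg, Complex.ofReal_sub, Pi.sub_apply]
  have hg0 : ∫ x in Ioi 0, g x = 0 := by
    have : ∫ x in Ioi 0, g x = (∫ x in Ioi (0 : ℝ), (prolateGuessH lam f0 f4 x : ℂ))
        - ∫ x in Ioi (0 : ℝ), (connesHermiteH x : ℂ) := by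
      rw [← integral_sub h1l integrableOn_ofReal_connesHermiteH_Ioi]
      refine setIntegral_congr_fun measurableSet_Ioi fun x _ ↦ ?_
      simp only [hg, Complex.ofReal_sub]
    rw [this, integral_ofReal_prolateGuessH_Ioi h0 h4 hint, integral_ofReal_connesHermiteH_Ioi, sub_zero]
  -- the weight
  have hW' : IntegrableOn (fun x : ℝ ↦ |Real.log x| * max 1 (x ^ ((s + 1 / 2).re - 1)) * ‖g x‖)
      (Ioi 0) := by
    refine hW.congr_fun (fun x _ ↦ ?_) measurableSet_Ioi
    simp only [hg, hwre, Complex.norm_real, Real.norm_eq_abs]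
  have key := norm_riemannZeta_mul_mellin_le_of_integral_eq_zero hgc hgi hg0 hW'
  rw [hmel, show s + 1 / 2 - 1 = s - 1 / 2 by ring] at key
  refine key.trans (le_of_eq ?_)
  congr 1
  refine setIntegral_congr_fun measurableSet_Ioi fun x _ ↦ ?_
  simp only [hg, hwre, Complex.norm_real, Real.norm_eq_abs]

/-- **Fact 6.4, unconditional skeleton.**  For prolate functions `h_{0,λ}, h_{4,λ}`, the guess `h_λ` with
`∫_0^λ h_λ = 0`, `M` a bound of `|h_λ|` on `[0,λ]`, `V_λ = TV(h_λ;[0,λ])`, `σ = Re s > −½`, `s ≠ ½`, and the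
integrability of the weight:

`‖4M_λ(s) − ξ(½+s)‖ ≤ 4|(s−½)ζ(s+½)| ∫_0^∞ |log x| max(1,x^{σ−½}) |h_λ(x) − h(x)| dx + 4(V_λ+M)λ^{-(σ+½)}/(σ+½)`.

Both terms on the right are RH-free and elementary.  The factor `|(s−½)ζ(s+½)|` is bounded on
bounded-height parts `|Im s| ≤ T` of the strip `|Re s| ≤ α₀ < ½` only; for the supremum over the whole
strip use `norm_four_mul_prolateGuessMellin_sub_riemannXi_le_of_deriv` below.  That the right side tends
to `0` (`h_λ1_{[0,λ]} → h` in the weighted `L¹` norm, `V_λ, M = O(1)`) is the prolate-asymptotics content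
of the Letter's Fact 6.4 and is NOT proved in the tree. [cite: Connes2026Letter, §6.4 Fact 6.4] -/
theorem norm_four_mul_prolateGuessMellin_sub_riemannXi_le {lam : ℝ} {f0 f4 : ℝ → ℝ}
    (h0 : IsProlateFunction lam 0 f0) (h4 : IsProlateFunction lam 4 f4)
    (hint : ∫ t in (0 : ℝ)..lam, prolateGuessH lam f0 f4 t = 0)
    {M : ℝ} (hM : ∀ t ∈ Icc 0 lam, |prolateGuessH lam f0 f4 t| ≤ M)
    {s : ℂ} (hs : -(1 / 2 : ℝ) < s.re) (hs1 : s ≠ 1 / 2)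
    (hW : IntegrableOn (fun x : ℝ ↦ |Real.log x| * max 1 (x ^ (s.re - 1 / 2))
      * |prolateGuessH lam f0 f4 x - connesHermiteH x|) (Ioi 0)) :
    ‖4 * prolateGuessMellin lam f0 f4 s - riemannXi (1 / 2 + s)‖ ≤
      4 * (‖(s - 1 / 2) * riemannZeta (s + 1 / 2)‖ *
          ∫ x in Ioi 0, |Real.log x| * max 1 (x ^ (s.re - 1 / 2))
            * |prolateGuessH lam f0 f4 x - connesHermiteH x|)
        + 4 * (((eVariationOn (prolateGuessH lam f0 f4) (Icc 0 lam)).toReal + M)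
          * lam ^ (-(s.re + 1 / 2)) / (s.re + 1 / 2)) := by
  set D := 4 * prolateGuessMellin lam f0 f4 s - riemannXi (1 / 2 + s) with hD
  set Z := 4 * riemannZeta (s + 1 / 2) *
      (mellin (fun x ↦ (prolateGuessH lam f0 f4 x : ℂ)) (s + 1 / 2)
        - mellin (fun x ↦ (connesHermiteH x : ℂ)) (s + 1 / 2)) with hZ
  have hB := norm_four_mul_prolateGuessMellin_sub_riemannXi_sub_le_of_bv h0 h4 hint hM hs hs1
  rw [← hD, ← hZ] at hB
  have hmain := norm_zeta_mul_mellin_prolateGuessH_sub_le h0 h4 hint hs hW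
  have hZn : ‖Z‖ ≤ 4 * (‖(s - 1 / 2) * riemannZeta (s + 1 / 2)‖ *
      ∫ x in Ioi 0, |Real.log x| * max 1 (x ^ (s.re - 1 / 2))
        * |prolateGuessH lam f0 f4 x - connesHermiteH x|) := by
    rw [hZ, mul_assoc, norm_mul]
    have h4n : ‖(4 : ℂ)‖ = 4 := by simp
    rw [h4n]
    exact mul_le_mul_of_nonneg_left hmain (by norm_num)
  calc ‖D‖ = ‖Z + (D - Z)‖ := by rw [add_sub_cancel]
    _ ≤ ‖Z‖ + ‖D - Z‖ := norm_add_le _ _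
    _ ≤ _ := add_le_add hZn hB

/-- The same with `∫_0^λ h_λ = 0` discharged: prolate functions are even (`IsProlateFunction.even`,
file `ProlateParity.lean`) and `∫ h_{0,λ} > 0` (`integral_pos_of_isProlateFunction_zero`).
[cite: Connes2026Letter, §6.4 Fact 6.4] -/
theorem norm_four_mul_prolateGuessMellin_sub_riemannXi_le_of_even {lam : ℝ} {f0 f4 : ℝ → ℝ}
    (h0 : IsProlateFunction lam 0 f0) (h4 : IsProlateFunction lam 4 f4)
    {M : ℝ} (hM : ∀ t ∈ Icc 0 lam, |prolateGuessH lam f0 f4 t| ≤ M)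
    {s : ℂ} (hs : -(1 / 2 : ℝ) < s.re) (hs1 : s ≠ 1 / 2)
    (hW : IntegrableOn (fun x : ℝ ↦ |Real.log x| * max 1 (x ^ (s.re - 1 / 2))
      * |prolateGuessH lam f0 f4 x - connesHermiteH x|) (Ioi 0)) :
    ‖4 * prolateGuessMellin lam f0 f4 s - riemannXi (1 / 2 + s)‖ ≤
      4 * (‖(s - 1 / 2) * riemannZeta (s + 1 / 2)‖ *
          ∫ x in Ioi 0, |Real.log x| * max 1 (x ^ (s.re - 1 / 2))
            * |prolateGuessH lam f0 f4 x - connesHermiteH x|)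
        + 4 * (((eVariationOn (prolateGuessH lam f0 f4) (Icc 0 lam)).toReal + M)
          * lam ^ (-(s.re + 1 / 2)) / (s.re + 1 / 2)) :=
  norm_four_mul_prolateGuessMellin_sub_riemannXi_le h0 h4
    (integral_zero_lam_prolateGuessH_eq_zero h0 h4 h0.even h4.even
      (integral_pos_of_isProlateFunction_zero h0).ne') hM hs hs1 hW

/-! ### Uniformity in `Im s`: one integration by parts -/

/-- `h′(x) = (−2π³x⁵ + 7π²x³ − 3πx)e^{−πx²}`, the derivative of the Hermite combination `h`.
[cite: ConnesConsaniMoscovici2025, §7 eq. (7.1)] -/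
noncomputable def connesHermiteH' (x : ℝ) : ℝ :=
  (-2 * π ^ 3 * x ^ 5 + 7 * π ^ 2 * x ^ 3 - 3 * π * x) * Real.exp (-π * x ^ 2)

/-- `h` is continuous. [folklore] -/
theorem continuous_connesHermiteH : Continuous connesHermiteH := by
  unfold connesHermiteH; fun_prop

/-- `h′ = connesHermiteH'`. [folklore] -/
theorem hasDerivAt_connesHermiteH (x : ℝ) : HasDerivAt connesHermiteH (connesHermiteH' x) x := by
  have a := (((hasDerivAt_pow 4 x).const_mul (π ^ 2)).fun_sub
    ((hasDerivAt_pow 2 x).const_mul (3 / 2 * π))).fun_mul (((hasDerivAt_pow 2 x).const_mul (-π)).exp)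
  have hfun : connesHermiteH =
      fun y : ℝ ↦ (π ^ 2 * y ^ 4 - 3 / 2 * π * y ^ 2) * Real.exp (-π * y ^ 2) := rfl
  rw [hfun]
  refine a.congr_deriv ?_
  simp only [connesHermiteH']
  push_cast
  ring

/-- `h′(x)·x^w` is integrable on `(0,∞)` for `Re w > 0`. [folklore] -/
theorem integrableOn_connesHermiteH'_mul_cpow {w : ℂ} (hw : 0 < w.re) :
    IntegrableOn (fun x : ℝ ↦ (connesHermiteH' x : ℂ) * (x : ℂ) ^ w) (Ioi 0) := by
  have hw1 : 0 < (w + 1).re := by simp; linarith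
  have i5 := mellinConvergent_pow_mul_exp_neg_pi_mul_sq 5 hw1
  have i3 := mellinConvergent_pow_mul_exp_neg_pi_mul_sq 3 hw1
  have i1 := mellinConvergent_pow_mul_exp_neg_pi_mul_sq 1 hw1
  rw [MellinConvergent] at i5 i3 i1
  have h : IntegrableOn (fun t : ℝ ↦
      (-2 : ℂ) * π ^ 3 * ((t : ℂ) ^ (w + 1 - 1) • ((t ^ 5 * Real.exp (-π * t ^ 2) : ℝ) : ℂ))
      + (7 : ℂ) * π ^ 2 * ((t : ℂ) ^ (w + 1 - 1) • ((t ^ 3 * Real.exp (-π * t ^ 2) : ℝ) : ℂ))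
      - (3 : ℂ) * π * ((t : ℂ) ^ (w + 1 - 1) • ((t ^ 1 * Real.exp (-π * t ^ 2) : ℝ) : ℂ))) (Ioi 0) :=
    ((i5.const_mul _).add (i3.const_mul _)).sub (i1.const_mul _)
  refine h.congr_fun (fun t _ ↦ ?_) measurableSet_Ioi
  simp only [connesHermiteH', smul_eq_mul, add_sub_cancel_right]
  push_cast
  ring

/-- `h(x)·x^a → 0` as `x → ∞` (Gaussian decay). [folklore] -/
theorem tendsto_connesHermiteH_mul_rpow_atTop (a : ℝ) :
    Tendsto (fun x : ℝ ↦ connesHermiteH x * x ^ a) atTop (𝓝 0) := by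
  have hexp : Tendsto (fun x : ℝ ↦ Real.exp (-(1 / 2) * x)) atTop (𝓝 0) :=
    Real.tendsto_exp_comp_nhds_zero.mpr (tendsto_id.const_mul_atTop_of_neg (by norm_num))
  have h4 : Tendsto (fun x : ℝ ↦ x ^ (4 + a) * Real.exp (-π * x ^ 2)) atTop (𝓝 0) :=
    (rpow_mul_exp_neg_mul_sq_isLittleO_exp_neg Real.pi_pos _).trans_tendsto hexp
  have h2 : Tendsto (fun x : ℝ ↦ x ^ (2 + a) * Real.exp (-π * x ^ 2)) atTop (𝓝 0) :=
    (rpow_mul_exp_neg_mul_sq_isLittleO_exp_neg Real.pi_pos _).trans_tendsto hexp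
  have h := (h4.const_mul (π ^ 2)).sub (h2.const_mul (3 / 2 * π))
  simp only [mul_zero, sub_zero] at h
  refine h.congr' ?_
  filter_upwards [eventually_gt_atTop (0 : ℝ)] with x hx
  simp only [connesHermiteH]
  rw [Real.rpow_add hx, Real.rpow_add hx, show (4 : ℝ) = ((4 : ℕ) : ℝ) by norm_num,
    show (2 : ℝ) = ((2 : ℕ) : ℝ) by norm_num, Real.rpow_natCast, Real.rpow_natCast]
  ring

/-- **`w·𝓜h(w) = −∫_0^∞ h′(x)x^w dx`** for `Re w > 0`. [folklore] -/
theorem mul_mellin_connesHermiteH {w : ℂ} (hw : 0 < w.re) :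
    w * mellin (fun x ↦ (connesHermiteH x : ℂ)) w =
      -∫ x in Ioi 0, (connesHermiteH' x : ℂ) * (x : ℂ) ^ w :=
  mul_mellin_eq_neg_integral_deriv continuous_connesHermiteH.continuousWithinAt
    (fun x _ ↦ hasDerivAt_connesHermiteH x) hw (mellinConvergent_connesHermiteH hw)
    (integrableOn_connesHermiteH'_mul_cpow hw) (tendsto_connesHermiteH_mul_rpow_atTop _)

/-- Differentiability package for `h_λ` on `(0, λ)`: `h_λ` is `C²` on `[−λ,λ]`, so on `(0,λ)` it has the
derivative `deriv h_λ`, which is bounded there and interval-integrable on `[0,λ]`. [folklore] -/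
theorem prolateGuessH_hasDerivAt {lam : ℝ} {f0 f4 : ℝ → ℝ} (h0 : IsProlateFunction lam 0 f0)
    (h4 : IsProlateFunction lam 4 f4) :
    (∀ x ∈ Ioo 0 lam, HasDerivAt (prolateGuessH lam f0 f4) (deriv (prolateGuessH lam f0 f4) x) x) ∧
      IntervalIntegrable (deriv (prolateGuessH lam f0 f4)) volume 0 lam := by
  have hlam : 0 < lam := h0.lam_pos
  set g := prolateGuessH lam f0 f4 with hg
  have hdef : g = fun x ↦ (Real.sqrt 3 / (2 : ℝ) ^ ((11 : ℝ) / 4)) *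
      (f4 x - ((∫ y in (-lam)..lam, f4 y) / (∫ y in (-lam)..lam, f0 y)) * f0 x) := rfl
  have hcd : ContDiffOn ℝ 2 g (Icc (-lam) lam) := by
    rw [hdef]
    exact contDiffOn_const.mul (h4.contDiffOn.sub (contDiffOn_const.mul h0.contDiffOn))
  have hnhds : ∀ x ∈ Ioo 0 lam, Icc (-lam) lam ∈ 𝓝 x := fun x hx ↦
    Icc_mem_nhds (by linarith [hx.1]) hx.2
  have hdiff : ∀ x ∈ Ioo 0 lam, HasDerivAt g (deriv g x) x := by
    intro x hx
    have hd : DifferentiableWithinAt ℝ g (Icc (-lam) lam) x :=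
      hcd.differentiableOn (by norm_num) x ⟨by linarith [hx.1], hx.2.le⟩
    exact (hd.differentiableAt (hnhds x hx)).hasDerivAt
  refine ⟨hdiff, ?_⟩
  -- boundedness of `deriv g` on `(0, λ)` via `derivWithin` on the compact `[−λ, λ]`
  have hcont : ContinuousOn (derivWithin g (Icc (-lam) lam)) (Icc (-lam) lam) :=
    hcd.continuousOn_derivWithin (uniqueDiffOn_Icc (by linarith)) (by norm_num)
  obtain ⟨C, hC⟩ := isCompact_Icc.exists_bound_of_continuousOn hcont
  have hbd : ∀ x ∈ Ioo 0 lam, ‖deriv g x‖ ≤ C := by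
    intro x hx
    rw [← derivWithin_of_mem_nhds (hnhds x hx)]
    exact hC x ⟨by linarith [hx.1], hx.2.le⟩
  rw [intervalIntegrable_iff_integrableOn_Ioo_of_le hlam.le]
  exact Measure.integrableOn_of_bounded (M := C) measure_Ioo_lt_top.ne
    (measurable_deriv g).aestronglyMeasurable (ae_restrict_of_forall_mem measurableSet_Ioo hbd)

/-- **`w·𝓜h_λ(w) = h_λ(λ)λ^w − ∫_0^λ h_λ′(x)x^w dx`** for `Re w > 0` (`h_λ` has a jump at `λ` in general).
[cite: Connes2026Letter, §6.4] -/
theorem mul_mellin_prolateGuessH {lam : ℝ} {f0 f4 : ℝ → ℝ} (h0 : IsProlateFunction lam 0 f0)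
    (h4 : IsProlateFunction lam 4 f4) {w : ℂ} (hw : 0 < w.re) :
    w * mellin (fun x ↦ (prolateGuessH lam f0 f4 x : ℂ)) w =
      (prolateGuessH lam f0 f4 lam : ℂ) * (lam : ℂ) ^ w
        - ∫ x in (0 : ℝ)..lam, ((deriv (prolateGuessH lam f0 f4) x : ℝ) : ℂ) * (x : ℂ) ^ w := by
  have hlam : 0 < lam := h0.lam_pos
  obtain ⟨⟨L, hL⟩, hsupp⟩ := prolateGuessH_lipschitz_support h0 h4
  obtain ⟨hd, hdi⟩ := prolateGuessH_hasDerivAt h0 h4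
  exact mul_mellin_eq_sub_integral_deriv hlam hL.continuousOn hd hdi hsupp hw

/-- **The integrated-by-parts form of the main term.**  For `Re w > 0`:
`w·(𝓜h_λ(w) − 𝓜h(w)) = h_λ(λ)λ^w − ∫_0^λ (h_λ′ − h′)(x) x^w dx + ∫_λ^∞ h′(x) x^w dx`.
[cite: Connes2026Letter, §6.4 Fact 6.4] -/
theorem mul_mellin_prolateGuessH_sub_eq {lam : ℝ} {f0 f4 : ℝ → ℝ} (h0 : IsProlateFunction lam 0 f0)
    (h4 : IsProlateFunction lam 4 f4) {w : ℂ} (hw : 0 < w.re) :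
    w * (mellin (fun x ↦ (prolateGuessH lam f0 f4 x : ℂ)) w - mellin (fun x ↦ (connesHermiteH x : ℂ)) w) =
      (prolateGuessH lam f0 f4 lam : ℂ) * (lam : ℂ) ^ w
        - (∫ x in (0 : ℝ)..lam,
            (((deriv (prolateGuessH lam f0 f4) x : ℝ) : ℂ) - (connesHermiteH' x : ℂ)) * (x : ℂ) ^ w)
        + ∫ x in Ioi lam, (connesHermiteH' x : ℂ) * (x : ℂ) ^ w := by
  have hlam : 0 < lam := h0.lam_pos
  obtain ⟨hd, hdi⟩ := prolateGuessH_hasDerivAt h0 h4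
  have hI := integrableOn_connesHermiteH'_mul_cpow hw
  -- split `∫_0^∞ h′ x^w = ∫_0^λ + ∫_λ^∞`
  have hsplit : ∫ x in Ioi 0, (connesHermiteH' x : ℂ) * (x : ℂ) ^ w =
      (∫ x in (0 : ℝ)..lam, (connesHermiteH' x : ℂ) * (x : ℂ) ^ w)
        + ∫ x in Ioi lam, (connesHermiteH' x : ℂ) * (x : ℂ) ^ w := by
    rw [← Ioc_union_Ioi_eq_Ioi hlam.le,
      setIntegral_union (Ioc_disjoint_Ioi le_rfl) measurableSet_Ioi
        (hI.mono_set Ioc_subset_Ioi_self) (hI.mono_set (Ioi_subset_Ioi hlam.le)),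
      intervalIntegral.integral_of_le hlam.le]
  -- interval integrability of the two pieces on `[0, λ]`
  have hJ1 : IntervalIntegrable (fun x : ℝ ↦ ((deriv (prolateGuessH lam f0 f4) x : ℝ) : ℂ) * (x : ℂ) ^ w)
      volume 0 lam := by
    have h1 : IntervalIntegrable (fun x : ℝ ↦ ((deriv (prolateGuessH lam f0 f4) x : ℝ) : ℂ)) volume 0 lam :=
      ⟨hdi.1.ofReal, hdi.2.ofReal⟩
    exact h1.mul_continuousOn ((Complex.continuous_ofReal_cpow_const hw).continuousOn)
  have hJ2 : IntervalIntegrable (fun x : ℝ ↦ (connesHermiteH' x : ℂ) * (x : ℂ) ^ w) volume 0 lam := by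
    rw [intervalIntegrable_iff_integrableOn_Ioc_of_le hlam.le]
    exact hI.mono_set Ioc_subset_Ioi_self
  have hsub : (∫ x in (0 : ℝ)..lam,
      (((deriv (prolateGuessH lam f0 f4) x : ℝ) : ℂ) - (connesHermiteH' x : ℂ)) * (x : ℂ) ^ w) =
      (∫ x in (0 : ℝ)..lam, ((deriv (prolateGuessH lam f0 f4) x : ℝ) : ℂ) * (x : ℂ) ^ w)
        - ∫ x in (0 : ℝ)..lam, (connesHermiteH' x : ℂ) * (x : ℂ) ^ w := by
    rw [← intervalIntegral.integral_sub hJ1 hJ2]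
    refine intervalIntegral.integral_congr fun x _ ↦ ?_
    simp only [sub_mul]
  rw [mul_sub, mul_mellin_prolateGuessH h0 h4 hw, mul_mellin_connesHermiteH hw, hsplit, hsub]
  ring

/-- Norm form: for `Re w > 0`,
`‖w·(𝓜h_λ(w) − 𝓜h(w))‖ ≤ |h_λ(λ)|λ^{Re w} + ∫_0^λ |h_λ′ − h′|(x) x^{Re w} dx + ∫_λ^∞ |h′(x)| x^{Re w} dx`.
[cite: Connes2026Letter, §6.4 Fact 6.4] -/
theorem norm_mul_mellin_prolateGuessH_sub_le {lam : ℝ} {f0 f4 : ℝ → ℝ}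
    (h0 : IsProlateFunction lam 0 f0) (h4 : IsProlateFunction lam 4 f4) {w : ℂ} (hw : 0 < w.re) :
    ‖w * (mellin (fun x ↦ (prolateGuessH lam f0 f4 x : ℂ)) w
        - mellin (fun x ↦ (connesHermiteH x : ℂ)) w)‖ ≤
      |prolateGuessH lam f0 f4 lam| * lam ^ w.re
        + (∫ x in (0 : ℝ)..lam, |deriv (prolateGuessH lam f0 f4) x - connesHermiteH' x| * x ^ w.re)
        + ∫ x in Ioi lam, |connesHermiteH' x| * x ^ w.re := by
  have hlam : 0 < lam := h0.lam_pos
  rw [mul_mellin_prolateGuessH_sub_eq h0 h4 hw]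
  have hnorm : ∀ (c x : ℝ), 0 ≤ x → ‖(c : ℂ) * (x : ℂ) ^ w‖ = |c| * x ^ w.re := fun c x hx ↦ by
    rw [norm_mul, Complex.norm_real, Real.norm_eq_abs, Complex.norm_cpow_eq_rpow_re_of_nonneg hx hw.ne']
  refine (norm_add_le _ _).trans (add_le_add ((norm_sub_le _ _).trans (add_le_add ?_ ?_)) ?_)
  · rw [hnorm _ _ hlam.le]
  · refine (intervalIntegral.norm_integral_le_integral_norm hlam.le).trans (le_of_eq ?_)
    refine intervalIntegral.integral_congr fun x hx ↦ ?_
    rw [uIcc_of_le hlam.le] at hx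
    have := hnorm (deriv (prolateGuessH lam f0 f4) x - connesHermiteH' x) x hx.1
    push_cast at this
    exact this
  · refine (MeasureTheory.norm_integral_le_integral_norm _).trans (le_of_eq ?_)
    refine setIntegral_congr_fun measurableSet_Ioi fun x hx ↦ hnorm _ _ (hlam.trans hx).le

/-- **Fact 6.4, unconditional skeleton, uniform in `Im s`.**  For prolate functions `h_{0,λ}, h_{4,λ}`,
the guess `h_λ` with `∫_0^λ h_λ = 0`, `M ≥ sup_{[0,λ]}|h_λ|`, `V_λ = TV(h_λ;[0,λ])`, `w = s+½`,
`σ' = Re s + ½ > 0`, `s ≠ ½`: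

`‖4M_λ(s) − ξ(½+s)‖ ≤ 4‖ζ(w)/w‖·(|h_λ(λ)|λ^{σ'} + ∫_0^λ |h_λ′ − h′|(x) x^{σ'} dx + ∫_λ^∞ |h′(x)| x^{σ'} dx)
                    + 4(V_λ + M)λ^{-σ'}/σ'`.

Every quantity on the right except `‖ζ(w)/w‖` is independent of `Im s`, and `‖ζ(w)/w‖ ≤ 1/(½−σ) + 1/(½+σ)`
on `|σ| < ½` (`norm_riemannZeta_div_le_of_abs_re_lt`; see `…_explicit` below for the substituted form).
The behaviour as `λ → ∞` of `V_λ, M, h_λ(λ)` and of the weighted `W^{1,1}` distance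
`∫_0^λ|h_λ′ − h′|x^{σ'}dx` is prolate asymptotics — the content of Fact 6.4 — and is NOT proved in the
tree. [cite: Connes2026Letter, §6.4 Fact 6.4] -/
theorem norm_four_mul_prolateGuessMellin_sub_riemannXi_le_of_deriv {lam : ℝ} {f0 f4 : ℝ → ℝ}
    (h0 : IsProlateFunction lam 0 f0) (h4 : IsProlateFunction lam 4 f4)
    (hint : ∫ t in (0 : ℝ)..lam, prolateGuessH lam f0 f4 t = 0)
    {M : ℝ} (hM : ∀ t ∈ Icc 0 lam, |prolateGuessH lam f0 f4 t| ≤ M)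
    {s : ℂ} (hs : -(1 / 2 : ℝ) < s.re) (hs1 : s ≠ 1 / 2) :
    ‖4 * prolateGuessMellin lam f0 f4 s - riemannXi (1 / 2 + s)‖ ≤
      4 * (‖riemannZeta (s + 1 / 2) / (s + 1 / 2)‖ *
          (|prolateGuessH lam f0 f4 lam| * lam ^ (s.re + 1 / 2)
            + (∫ x in (0 : ℝ)..lam,
                |deriv (prolateGuessH lam f0 f4) x - connesHermiteH' x| * x ^ (s.re + 1 / 2))
            + ∫ x in Ioi lam, |connesHermiteH' x| * x ^ (s.re + 1 / 2)))
        + 4 * (((eVariationOn (prolateGuessH lam f0 f4) (Icc 0 lam)).toReal + M)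
          * lam ^ (-(s.re + 1 / 2)) / (s.re + 1 / 2)) := by
  set w : ℂ := s + 1 / 2 with hw_def
  have hw : 0 < w.re := by
    simp only [hw_def, add_re, one_div]
    norm_num
    linarith
  have hwre : w.re = s.re + 1 / 2 := by
    simp only [hw_def, add_re, one_div]
    norm_num
  have hw0 : w ≠ 0 := by
    rintro h
    rw [h] at hw
    simp at hw
  set D := 4 * prolateGuessMellin lam f0 f4 s - riemannXi (1 / 2 + s) with hD
  set E := mellin (fun x ↦ (prolateGuessH lam f0 f4 x : ℂ)) w
      - mellin (fun x ↦ (connesHermiteH x : ℂ)) w with hE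
  set Z := 4 * riemannZeta w * E with hZ
  have hB := norm_four_mul_prolateGuessMellin_sub_riemannXi_sub_le_of_bv h0 h4 hint hM hs hs1
  rw [← hD, ← hw_def, ← hE, ← hZ] at hB
  have hmain := norm_mul_mellin_prolateGuessH_sub_le h0 h4 hw
  rw [← hE, hwre] at hmain
  have hZeq : Z = 4 * ((riemannZeta w / w) * (w * E)) := by
    rw [hZ]; field_simp
  have hZn : ‖Z‖ ≤ 4 * (‖riemannZeta w / w‖ *
      (|prolateGuessH lam f0 f4 lam| * lam ^ (s.re + 1 / 2)
        + (∫ x in (0 : ℝ)..lam,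
            |deriv (prolateGuessH lam f0 f4) x - connesHermiteH' x| * x ^ (s.re + 1 / 2))
        + ∫ x in Ioi lam, |connesHermiteH' x| * x ^ (s.re + 1 / 2))) := by
    rw [hZeq, norm_mul, norm_mul]
    have h4n : ‖(4 : ℂ)‖ = 4 := by simp
    rw [h4n]
    gcongr
  calc ‖D‖ = ‖Z + (D - Z)‖ := by rw [add_sub_cancel]
    _ ≤ ‖Z‖ + ‖D - Z‖ := norm_add_le _ _
    _ ≤ _ := add_le_add hZn hB

/-- The same with `∫_0^λ h_λ = 0` discharged: prolate functions are even (`IsProlateFunction.even`,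
file `ProlateParity.lean`) and `∫ h_{0,λ} > 0` (`integral_pos_of_isProlateFunction_zero`).
[cite: Connes2026Letter, §6.4 Fact 6.4] -/
theorem norm_four_mul_prolateGuessMellin_sub_riemannXi_le_of_deriv_of_even {lam : ℝ} {f0 f4 : ℝ → ℝ}
    (h0 : IsProlateFunction lam 0 f0) (h4 : IsProlateFunction lam 4 f4)
    {M : ℝ} (hM : ∀ t ∈ Icc 0 lam, |prolateGuessH lam f0 f4 t| ≤ M)
    {s : ℂ} (hs : -(1 / 2 : ℝ) < s.re) (hs1 : s ≠ 1 / 2) :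
    ‖4 * prolateGuessMellin lam f0 f4 s - riemannXi (1 / 2 + s)‖ ≤
      4 * (‖riemannZeta (s + 1 / 2) / (s + 1 / 2)‖ *
          (|prolateGuessH lam f0 f4 lam| * lam ^ (s.re + 1 / 2)
            + (∫ x in (0 : ℝ)..lam,
                |deriv (prolateGuessH lam f0 f4) x - connesHermiteH' x| * x ^ (s.re + 1 / 2))
            + ∫ x in Ioi lam, |connesHermiteH' x| * x ^ (s.re + 1 / 2)))
        + 4 * (((eVariationOn (prolateGuessH lam f0 f4) (Icc 0 lam)).toReal + M)
          * lam ^ (-(s.re + 1 / 2)) / (s.re + 1 / 2)) :=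
  norm_four_mul_prolateGuessMellin_sub_riemannXi_le_of_deriv h0 h4
    (integral_zero_lam_prolateGuessH_eq_zero h0 h4 h0.even h4.even
      (integral_pos_of_isProlateFunction_zero h0).ne') hM hs hs1

/-- `‖ζ(w)/w‖ ≤ 1/‖w−1‖ + 1/Re w` for `Re w > 0`, `w ≠ 1` (Titchmarsh (2.12.2), from the tree's
`norm_riemannZeta_le_of_re_pos`). [cite: Titchmarsh1986, §2.12 eq. (2.12.2)] -/
theorem norm_riemannZeta_div_le {w : ℂ} (hw : 0 < w.re) (hw1 : w ≠ 1) :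
    ‖riemannZeta w / w‖ ≤ 1 / ‖w - 1‖ + 1 / w.re := by
  have hw0 : w ≠ 0 := by
    rintro rfl
    simp at hw
  have hwn : 0 < ‖w‖ := norm_pos_iff.mpr hw0
  have h := norm_riemannZeta_le_of_re_pos hw hw1
  rw [norm_div, div_le_iff₀ hwn]
  calc ‖riemannZeta w‖ ≤ ‖w‖ / ‖w - 1‖ + ‖w‖ / w.re := h
    _ = (1 / ‖w - 1‖ + 1 / w.re) * ‖w‖ := by ring

/-- On the open critical strip in the Letter's variable: for `|Re s| < ½`, with `w = s + ½`,
`‖ζ(w)/w‖ ≤ 1/(½ − Re s) + 1/(½ + Re s)` — uniformly in `Im s`. [cite: Titchmarsh1986, §2.12 eq. (2.12.2)] -/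
theorem norm_riemannZeta_div_le_of_abs_re_lt {s : ℂ} (hs : |s.re| < 1 / 2) :
    ‖riemannZeta (s + 1 / 2) / (s + 1 / 2)‖ ≤ 1 / (1 / 2 - s.re) + 1 / (1 / 2 + s.re) := by
  obtain ⟨hs1, hs2⟩ := abs_lt.mp hs
  have hre : (s + 1 / 2).re = s.re + 1 / 2 := by simp
  have hw : 0 < (s + 1 / 2).re := by rw [hre]; linarith
  have hw1 : s + 1 / 2 ≠ 1 := by
    intro h
    have := congrArg Complex.re h
    rw [hre, Complex.one_re] at this
    linarith
  have h := norm_riemannZeta_div_le hw hw1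
  have hsub : 1 / 2 - s.re ≤ ‖s + 1 / 2 - 1‖ := by
    have h1 : |(s + 1 / 2 - 1).re| ≤ ‖s + 1 / 2 - 1‖ := Complex.abs_re_le_norm _
    have h2 : (s + 1 / 2 - 1).re = s.re - 1 / 2 := by simp; ring
    rw [h2, abs_sub_comm, abs_of_pos (by linarith)] at h1
    exact h1
  calc ‖riemannZeta (s + 1 / 2) / (s + 1 / 2)‖ ≤ 1 / ‖s + 1 / 2 - 1‖ + 1 / (s + 1 / 2).re := h
    _ ≤ 1 / (1 / 2 - s.re) + 1 / (1 / 2 + s.re) := by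
        rw [hre, add_comm s.re]
        gcongr

/-- **Fact 6.4, unconditional skeleton, fully explicit and free of `Im s`.**  For prolate functions
`h_{0,λ}, h_{4,λ}`, the guess `h_λ` with `∫_0^λ h_λ = 0`, `M ≥ sup_{[0,λ]}|h_λ|`, `V_λ = TV(h_λ;[0,λ])`,
and `|σ| < ½`, `σ = Re s`:

`‖4M_λ(s) − ξ(½+s)‖ ≤ 4(1/(½−σ) + 1/(½+σ))·(|h_λ(λ)|λ^{σ+½} + ∫_0^λ |h_λ′ − h′|(x)x^{σ+½}dx + ∫_λ^∞ |h′(x)|x^{σ+½}dx)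
                    + 4(V_λ + M)λ^{-(σ+½)}/(σ+½)`.

The right side does not depend on `Im s`; it is RH-free and elementary (Müntz's formula, Riemann's
`ξ = 4ζ𝓜h`, one integration by parts, Titchmarsh (2.12.2)).  Fact 6.4 as printed — `sup_{|Re s| ≤ α₀}
‖4M_λ(s) − ξ(½+s)‖ → 0` — thus follows from the prolate asymptotics `V_λ, M = O(1)`, `λ·h_λ(λ) → 0`,
`∫_0^λ |h_λ′ − h′|(x)(x^{½−α₀} + x^{½+α₀})dx → 0`, which are NOT proved in the tree.
[cite: Connes2026Letter, §6.4 Fact 6.4] -/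
theorem norm_four_mul_prolateGuessMellin_sub_riemannXi_le_explicit {lam : ℝ} {f0 f4 : ℝ → ℝ}
    (h0 : IsProlateFunction lam 0 f0) (h4 : IsProlateFunction lam 4 f4)
    (hint : ∫ t in (0 : ℝ)..lam, prolateGuessH lam f0 f4 t = 0)
    {M : ℝ} (hM : ∀ t ∈ Icc 0 lam, |prolateGuessH lam f0 f4 t| ≤ M)
    {s : ℂ} (hs : |s.re| < 1 / 2) :
    ‖4 * prolateGuessMellin lam f0 f4 s - riemannXi (1 / 2 + s)‖ ≤
      4 * ((1 / (1 / 2 - s.re) + 1 / (1 / 2 + s.re)) *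
          (|prolateGuessH lam f0 f4 lam| * lam ^ (s.re + 1 / 2)
            + (∫ x in (0 : ℝ)..lam,
                |deriv (prolateGuessH lam f0 f4) x - connesHermiteH' x| * x ^ (s.re + 1 / 2))
            + ∫ x in Ioi lam, |connesHermiteH' x| * x ^ (s.re + 1 / 2)))
        + 4 * (((eVariationOn (prolateGuessH lam f0 f4) (Icc 0 lam)).toReal + M)
          * lam ^ (-(s.re + 1 / 2)) / (s.re + 1 / 2)) := by
  have hlam : 0 < lam := h0.lam_pos
  obtain ⟨hs1, hs2⟩ := abs_lt.mp hs
  have hs' : -(1 / 2 : ℝ) < s.re := by linarith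
  have hs1' : s ≠ 1 / 2 := by
    intro h
    rw [h] at hs2
    norm_num at hs2
  have h := norm_four_mul_prolateGuessMellin_sub_riemannXi_le_of_deriv h0 h4 hint hM hs' hs1'
  refine h.trans (add_le_add ?_ le_rfl)
  have hζ := norm_riemannZeta_div_le_of_abs_re_lt hs
  have hP : 0 ≤ |prolateGuessH lam f0 f4 lam| * lam ^ (s.re + 1 / 2)
      + (∫ x in (0 : ℝ)..lam,
          |deriv (prolateGuessH lam f0 f4) x - connesHermiteH' x| * x ^ (s.re + 1 / 2))
      + ∫ x in Ioi lam, |connesHermiteH' x| * x ^ (s.re + 1 / 2) := by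
    refine add_nonneg (add_nonneg (by positivity) ?_) ?_
    · refine intervalIntegral.integral_nonneg hlam.le fun x hx ↦ ?_
      exact mul_nonneg (abs_nonneg _) (Real.rpow_nonneg hx.1 _)
    · refine setIntegral_nonneg measurableSet_Ioi fun x hx ↦ ?_
      exact mul_nonneg (abs_nonneg _) (Real.rpow_nonneg (hlam.trans hx).le _)
  gcongr

/-- The same with `∫_0^λ h_λ = 0` discharged: prolate functions are even (`IsProlateFunction.even`,
file `ProlateParity.lean`) and `∫ h_{0,λ} > 0` (`integral_pos_of_isProlateFunction_zero`).
[cite: Connes2026Letter, §6.4 Fact 6.4] -/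
theorem norm_four_mul_prolateGuessMellin_sub_riemannXi_le_explicit_of_even {lam : ℝ} {f0 f4 : ℝ → ℝ}
    (h0 : IsProlateFunction lam 0 f0) (h4 : IsProlateFunction lam 4 f4)
    {M : ℝ} (hM : ∀ t ∈ Icc 0 lam, |prolateGuessH lam f0 f4 t| ≤ M)
    {s : ℂ} (hs : |s.re| < 1 / 2) :
    ‖4 * prolateGuessMellin lam f0 f4 s - riemannXi (1 / 2 + s)‖ ≤
      4 * ((1 / (1 / 2 - s.re) + 1 / (1 / 2 + s.re)) *
          (|prolateGuessH lam f0 f4 lam| * lam ^ (s.re + 1 / 2)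
            + (∫ x in (0 : ℝ)..lam,
                |deriv (prolateGuessH lam f0 f4) x - connesHermiteH' x| * x ^ (s.re + 1 / 2))
            + ∫ x in Ioi lam, |connesHermiteH' x| * x ^ (s.re + 1 / 2)))
        + 4 * (((eVariationOn (prolateGuessH lam f0 f4) (Icc 0 lam)).toReal + M)
          * lam ^ (-(s.re + 1 / 2)) / (s.re + 1 / 2)) :=
  norm_four_mul_prolateGuessMellin_sub_riemannXi_le_explicit h0 h4
    (integral_zero_lam_prolateGuessH_eq_zero h0 h4 h0.even h4.even
      (integral_pos_of_isProlateFunction_zero h0).ne') hM hs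

/-! ### The bound made uniform on the closed substrip `|Re s| ≤ α₀ < ½` -/

/-- For `x > 0` and `a ≤ c ≤ b`: `x^c ≤ x^a + x^b`. [folklore] -/
theorem rpow_le_rpow_add_rpow {x a b c : ℝ} (hx : 0 < x) (hac : a ≤ c) (hcb : c ≤ b) :
    x ^ c ≤ x ^ a + x ^ b := by
  rcases le_total x 1 with h | h
  · have h1 : x ^ c ≤ x ^ a := Real.rpow_le_rpow_of_exponent_ge hx h hac
    linarith [Real.rpow_nonneg hx.le b]
  · have h1 : x ^ c ≤ x ^ b := Real.rpow_le_rpow_of_exponent_le h hcb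
    linarith [Real.rpow_nonneg hx.le a]

/-- `h′` is continuous. [folklore] -/
theorem continuous_connesHermiteH' : Continuous connesHermiteH' := by
  unfold connesHermiteH'
  fun_prop

/-- `|h′(x)|·x^c` is integrable on `(0, ∞)` for `c > 0`. [folklore] -/
theorem integrableOn_abs_connesHermiteH'_mul_rpow {c : ℝ} (hc : 0 < c) :
    IntegrableOn (fun x : ℝ ↦ |connesHermiteH' x| * x ^ c) (Ioi 0) := by
  have h : IntegrableOn (fun x : ℝ ↦ ‖(connesHermiteH' x : ℂ) * (x : ℂ) ^ (c : ℂ)‖) (Ioi 0) :=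
    (integrableOn_connesHermiteH'_mul_cpow (w := (c : ℂ)) (by simpa using hc)).norm
  refine h.congr_fun (fun x hx ↦ ?_) measurableSet_Ioi
  simp only []
  rw [norm_mul, Complex.norm_real, Real.norm_eq_abs,
    Complex.norm_cpow_eq_rpow_re_of_pos (mem_Ioi.mp hx), Complex.ofReal_re]

/-- **Fact 6.4, unconditional skeleton, uniform on the closed substrip.**  For prolate functions
`h_{0,λ}, h_{4,λ}` with `λ ≥ 1`, the guess `h_λ` with `∫_0^λ h_λ = 0`, `M ≥ sup_{[0,λ]}|h_λ|`,
`V_λ = TV(h_λ;[0,λ])`, `0 ≤ α₀ < ½`, and EVERY `s` with `|Re s| ≤ α₀`: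

`‖4M_λ(s) − ξ(½+s)‖ ≤ (4/(¼−α₀²))·(|h_λ(λ)|·λ + ∫_0^λ |h_λ′ − h′|(x)(x^{½−α₀} + x^{½+α₀})dx
                        + ∫_λ^∞ |h′(x)|(x^{½−α₀} + x^{½+α₀})dx) + 4(V_λ + M)λ^{-(½−α₀)}/(½−α₀)`.

The right-hand side `R(λ, α₀)` does NOT depend on `s`: hence
`sup_{|Re s| ≤ α₀} ‖4M_λ(s) − ξ(½+s)‖ ≤ R(λ, α₀)`, and Fact 6.4 as printed in the Letter follows at once
from `R(λ, α₀) → 0 (λ → ∞)`, i.e. from the prolate asymptotics `λh_λ(λ) → 0`,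
`∫_0^λ|h_λ′ − h′|(x^{½−α₀} + x^{½+α₀}) → 0`, `(V_λ + M_λ)λ^{-(½−α₀)} → 0` (the `h′`-tail is a Gaussian
tail and tends to `0`: `tendsto_integral_Ioi_abs_connesHermiteH'_atTop` below).  These asymptotics are
NOT proved in the tree; nothing here uses RH.
[cite: Connes2026Letter, §6.4 Fact 6.4] -/
theorem norm_four_mul_prolateGuessMellin_sub_riemannXi_le_uniform {lam : ℝ} {f0 f4 : ℝ → ℝ}
    (h0 : IsProlateFunction lam 0 f0) (h4 : IsProlateFunction lam 4 f4)
    (hint : ∫ t in (0 : ℝ)..lam, prolateGuessH lam f0 f4 t = 0) (hlam1 : 1 ≤ lam)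
    {M : ℝ} (hM : ∀ t ∈ Icc 0 lam, |prolateGuessH lam f0 f4 t| ≤ M)
    {α₀ : ℝ} (hα : 0 ≤ α₀) (hα' : α₀ < 1 / 2) {s : ℂ} (hs : |s.re| ≤ α₀) :
    ‖4 * prolateGuessMellin lam f0 f4 s - riemannXi (1 / 2 + s)‖ ≤
      4 / (1 / 4 - α₀ ^ 2) *
          (|prolateGuessH lam f0 f4 lam| * lam
            + (∫ x in (0 : ℝ)..lam, |deriv (prolateGuessH lam f0 f4) x - connesHermiteH' x|
                * (x ^ (1 / 2 - α₀) + x ^ (1 / 2 + α₀)))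
            + ∫ x in Ioi lam, |connesHermiteH' x| * (x ^ (1 / 2 - α₀) + x ^ (1 / 2 + α₀)))
        + 4 * (((eVariationOn (prolateGuessH lam f0 f4) (Icc 0 lam)).toReal + M)
          * lam ^ (-(1 / 2 - α₀)) / (1 / 2 - α₀)) := by
  obtain ⟨hs1, hs2⟩ := abs_le.mp hs
  have hsabs : |s.re| < 1 / 2 := lt_of_le_of_lt hs hα'
  have hlam : 0 < lam := h0.lam_pos
  have ha : 0 < 1 / 2 - α₀ := by linarith
  have hσa : 1 / 2 - α₀ ≤ s.re + 1 / 2 := by linarith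
  have hσb : s.re + 1 / 2 ≤ 1 / 2 + α₀ := by linarith
  have hσpos : 0 < s.re + 1 / 2 := lt_of_lt_of_le ha hσa
  have hσ1 : s.re + 1 / 2 ≤ 1 := by linarith
  have h := norm_four_mul_prolateGuessMellin_sub_riemannXi_le_explicit h0 h4 hint hM hsabs
  -- abbreviations
  set g : ℝ → ℝ := fun x ↦ |deriv (prolateGuessH lam f0 f4) x - connesHermiteH' x| with hg_def
  set V : ℝ := (eVariationOn (prolateGuessH lam f0 f4) (Icc 0 lam)).toReal with hV_def
  -- the factor `ζ(w)/w`
  have hq : 0 < 1 / 4 - α₀ ^ 2 := by nlinarith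
  have hF : 1 / (1 / 2 - s.re) + 1 / (1 / 2 + s.re) ≤ 1 / (1 / 4 - α₀ ^ 2) := by
    have hne1 : (1 / 2 - s.re) ≠ 0 := by linarith
    have hne2 : (1 / 2 + s.re) ≠ 0 := by linarith
    have e1 : 1 / (1 / 2 - s.re) + 1 / (1 / 2 + s.re) = 1 / (1 / 4 - s.re ^ 2) := by
      have : (1 / 4 - s.re ^ 2) = (1 / 2 - s.re) * (1 / 2 + s.re) := by ring
      rw [this, div_add_div _ _ hne1 hne2]
      congr 1
      ring
    have e2 : s.re ^ 2 ≤ α₀ ^ 2 := sq_le_sq' (by linarith) hs2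
    rw [e1]
    exact one_div_le_one_div_of_le hq (by linarith)
  have hF0 : 0 ≤ 1 / (1 / 4 - α₀ ^ 2) := div_nonneg (by norm_num) hq.le
  -- integrability of the weighted integrands on `[0, λ]`
  have hgi : IntervalIntegrable g volume 0 lam :=
    ((prolateGuessH_hasDerivAt h0 h4).2.sub
      (continuous_connesHermiteH'.intervalIntegrable _ _)).abs
  have hcont : ∀ {c : ℝ}, 0 ≤ c → ContinuousOn (fun x : ℝ ↦ x ^ c) (uIcc 0 lam) :=
    fun hc ↦ (Real.continuous_rpow_const hc).continuousOn
  have hI1 : IntervalIntegrable (fun x ↦ g x * x ^ (s.re + 1 / 2)) volume 0 lam :=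
    hgi.mul_continuousOn (hcont hσpos.le)
  have hI2 : IntervalIntegrable (fun x ↦ g x * (x ^ (1 / 2 - α₀) + x ^ (1 / 2 + α₀)))
      volume 0 lam :=
    hgi.mul_continuousOn ((hcont ha.le).add (hcont (by linarith)))
  -- (t1) the endpoint term
  have t1 : |prolateGuessH lam f0 f4 lam| * lam ^ (s.re + 1 / 2) ≤
      |prolateGuessH lam f0 f4 lam| * lam := by
    refine mul_le_mul_of_nonneg_left ?_ (abs_nonneg _)
    calc lam ^ (s.re + 1 / 2) ≤ lam ^ (1 : ℝ) := Real.rpow_le_rpow_of_exponent_le hlam1 hσ1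
      _ = lam := Real.rpow_one lam
  -- (t2) the weighted `W^{1,1}` term
  have t2 : (∫ x in (0 : ℝ)..lam, g x * x ^ (s.re + 1 / 2)) ≤
      ∫ x in (0 : ℝ)..lam, g x * (x ^ (1 / 2 - α₀) + x ^ (1 / 2 + α₀)) := by
    refine intervalIntegral.integral_mono_on_of_le_Ioo hlam.le hI1 hI2 fun x hx ↦ ?_
    exact mul_le_mul_of_nonneg_left (rpow_le_rpow_add_rpow hx.1 hσa hσb) (abs_nonneg _)
  -- (t3) the Gaussian tail
  have t3 : (∫ x in Ioi lam, |connesHermiteH' x| * x ^ (s.re + 1 / 2)) ≤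
      ∫ x in Ioi lam, |connesHermiteH' x| * (x ^ (1 / 2 - α₀) + x ^ (1 / 2 + α₀)) := by
    have hsub : Ioi lam ⊆ Ioi 0 := Ioi_subset_Ioi hlam.le
    refine setIntegral_mono_on ((integrableOn_abs_connesHermiteH'_mul_rpow hσpos).mono_set hsub)
      ?_ measurableSet_Ioi fun x hx ↦ ?_
    · have := ((integrableOn_abs_connesHermiteH'_mul_rpow ha).add
        (integrableOn_abs_connesHermiteH'_mul_rpow (c := 1 / 2 + α₀) (by linarith))).mono_set hsub
      refine this.congr_fun (fun x _ ↦ ?_) measurableSet_Ioi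
      simp only [Pi.add_apply]
      ring
    · exact mul_le_mul_of_nonneg_left
        (rpow_le_rpow_add_rpow (hlam.trans (mem_Ioi.mp hx)) hσa hσb) (abs_nonneg _)
  -- (t4) the boundary term
  have hM0 : 0 ≤ M := (abs_nonneg _).trans (hM 0 ⟨le_rfl, hlam.le⟩)
  have hVM : 0 ≤ V + M := add_nonneg ENNReal.toReal_nonneg hM0
  have t4 : (V + M) * lam ^ (-(s.re + 1 / 2)) / (s.re + 1 / 2) ≤
      (V + M) * lam ^ (-(1 / 2 - α₀)) / (1 / 2 - α₀) := by
    have e1 : lam ^ (-(s.re + 1 / 2)) ≤ lam ^ (-(1 / 2 - α₀)) :=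
      Real.rpow_le_rpow_of_exponent_le hlam1 (by linarith)
    have e2 : (V + M) * lam ^ (-(s.re + 1 / 2)) ≤ (V + M) * lam ^ (-(1 / 2 - α₀)) :=
      mul_le_mul_of_nonneg_left e1 hVM
    exact div_le_div₀ (mul_nonneg hVM (Real.rpow_nonneg hlam.le _)) e2 ha hσa
  -- nonnegativity of the brackets
  have hP0 : 0 ≤ |prolateGuessH lam f0 f4 lam| * lam ^ (s.re + 1 / 2)
      + (∫ x in (0 : ℝ)..lam, g x * x ^ (s.re + 1 / 2))
      + ∫ x in Ioi lam, |connesHermiteH' x| * x ^ (s.re + 1 / 2) := by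
    refine add_nonneg (add_nonneg (by positivity) ?_) ?_
    · refine intervalIntegral.integral_nonneg hlam.le fun x hx ↦ ?_
      exact mul_nonneg (abs_nonneg _) (Real.rpow_nonneg hx.1 _)
    · refine setIntegral_nonneg measurableSet_Ioi fun x hx ↦ ?_
      exact mul_nonneg (abs_nonneg _) (Real.rpow_nonneg (hlam.trans hx).le _)
  have hP := add_le_add (add_le_add t1 t2) t3
  calc ‖4 * prolateGuessMellin lam f0 f4 s - riemannXi (1 / 2 + s)‖
      ≤ 4 * ((1 / (1 / 2 - s.re) + 1 / (1 / 2 + s.re)) *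
          (|prolateGuessH lam f0 f4 lam| * lam ^ (s.re + 1 / 2)
            + (∫ x in (0 : ℝ)..lam, g x * x ^ (s.re + 1 / 2))
            + ∫ x in Ioi lam, |connesHermiteH' x| * x ^ (s.re + 1 / 2)))
        + 4 * ((V + M) * lam ^ (-(s.re + 1 / 2)) / (s.re + 1 / 2)) := h
    _ ≤ 4 * (1 / (1 / 4 - α₀ ^ 2) *
          (|prolateGuessH lam f0 f4 lam| * lam
            + (∫ x in (0 : ℝ)..lam, g x * (x ^ (1 / 2 - α₀) + x ^ (1 / 2 + α₀)))
            + ∫ x in Ioi lam, |connesHermiteH' x| * (x ^ (1 / 2 - α₀) + x ^ (1 / 2 + α₀))))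
        + 4 * ((V + M) * lam ^ (-(1 / 2 - α₀)) / (1 / 2 - α₀)) := by
        exact add_le_add (mul_le_mul_of_nonneg_left (mul_le_mul hF hP hP0 hF0) (by norm_num))
          (mul_le_mul_of_nonneg_left t4 (by norm_num))
    _ = _ := by ring

/-- Tails of an integrable function: `∫_{(λ,∞)} F → 0` as `λ → ∞`. [folklore] -/
theorem tendsto_setIntegral_Ioi_atTop_zero {F : ℝ → ℝ} (hF : IntegrableOn F (Ioi 0)) :
    Tendsto (fun lam : ℝ ↦ ∫ x in Ioi lam, F x) atTop (𝓝 0) := by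
  have h := tendsto_setIntegral_of_antitone (μ := volume) (f := F) (s := fun lam : ℝ ↦ Ioi lam)
    (fun _ ↦ measurableSet_Ioi) (fun a b hab ↦ Ioi_subset_Ioi hab) ⟨0, hF⟩
  have he : (⋂ n : ℝ, Ioi n) = ∅ := by
    ext x
    simp only [mem_iInter, mem_Ioi, mem_empty_iff_false, iff_false, not_forall, not_lt]
    exact ⟨x, le_rfl⟩
  simpa [he] using h

/-- The `h′`-tail in the uniform bound is a Gaussian tail and tends to `0`:
`∫_λ^∞ |h′(x)|(x^a + x^b)dx → 0` as `λ → ∞` (`a, b > 0`). [folklore] -/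
theorem tendsto_integral_Ioi_abs_connesHermiteH'_atTop {a b : ℝ} (ha : 0 < a) (hb : 0 < b) :
    Tendsto (fun lam : ℝ ↦ ∫ x in Ioi lam, |connesHermiteH' x| * (x ^ a + x ^ b)) atTop (𝓝 0) := by
  have hF : IntegrableOn (fun x : ℝ ↦ |connesHermiteH' x| * (x ^ a + x ^ b)) (Ioi 0) := by
    have := (integrableOn_abs_connesHermiteH'_mul_rpow ha).add
      (integrableOn_abs_connesHermiteH'_mul_rpow hb)
    refine this.congr_fun (fun x _ ↦ ?_) measurableSet_Ioi
    simp only [Pi.add_apply]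
    ring
  exact tendsto_setIntegral_Ioi_atTop_zero hF

/-- The same with `∫_0^λ h_λ = 0` discharged: prolate functions are even (`IsProlateFunction.even`,
file `ProlateParity.lean`) and `∫ h_{0,λ} > 0` (`integral_pos_of_isProlateFunction_zero`).
[cite: Connes2026Letter, §6.4 Fact 6.4] -/
theorem norm_four_mul_prolateGuessMellin_sub_riemannXi_le_uniform_of_even {lam : ℝ} {f0 f4 : ℝ → ℝ}
    (h0 : IsProlateFunction lam 0 f0) (h4 : IsProlateFunction lam 4 f4)
    (hlam1 : 1 ≤ lam) {M : ℝ} (hM : ∀ t ∈ Icc 0 lam, |prolateGuessH lam f0 f4 t| ≤ M)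
    {α₀ : ℝ} (hα : 0 ≤ α₀) (hα' : α₀ < 1 / 2) {s : ℂ} (hs : |s.re| ≤ α₀) :
    ‖4 * prolateGuessMellin lam f0 f4 s - riemannXi (1 / 2 + s)‖ ≤
      4 / (1 / 4 - α₀ ^ 2) *
          (|prolateGuessH lam f0 f4 lam| * lam
            + (∫ x in (0 : ℝ)..lam, |deriv (prolateGuessH lam f0 f4) x - connesHermiteH' x|
                * (x ^ (1 / 2 - α₀) + x ^ (1 / 2 + α₀)))
            + ∫ x in Ioi lam, |connesHermiteH' x| * (x ^ (1 / 2 - α₀) + x ^ (1 / 2 + α₀)))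
        + 4 * (((eVariationOn (prolateGuessH lam f0 f4) (Icc 0 lam)).toReal + M)
          * lam ^ (-(1 / 2 - α₀)) / (1 / 2 - α₀)) :=
  norm_four_mul_prolateGuessMellin_sub_riemannXi_le_uniform h0 h4
    (integral_zero_lam_prolateGuessH_eq_zero h0 h4 h0.even h4.even
      (integral_pos_of_isProlateFunction_zero h0).ne') hlam1 hM hα hα' hs


/-- Total variation is bounded by the integral of `|f′|`: if `f` is continuous on `[a, b]` with a
derivative `f′` on `(a, b)` that is integrable on `[a, b]`, then `V_a^b(f) ≤ ∫_a^b |f′|`. [folklore] -/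
theorem eVariationOn_Icc_le_integral_abs_deriv {f f' : ℝ → ℝ} {a b : ℝ} (hab : a ≤ b)
    (hcont : ContinuousOn f (Icc a b)) (hderiv : ∀ x ∈ Ioo a b, HasDerivAt f (f' x) x)
    (hint : IntervalIntegrable f' volume a b) :
    eVariationOn f (Icc a b) ≤ ENNReal.ofReal (∫ x in a..b, |f' x|) := by
  apply iSup_le
  rintro ⟨n, u, hu, hus⟩
  have habs : IntervalIntegrable (fun x ↦ |f' x|) volume a b := hint.abs
  -- each increment is bounded by the integral of `|f′|` over the corresponding interval
  have hpiece : ∀ i j, i ≤ j → IntervalIntegrable (fun x ↦ |f' x|) volume (u i) (u j) := by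
    intro i j hij
    refine habs.mono_set ?_
    rw [uIcc_of_le (hu hij), uIcc_of_le hab]
    exact Icc_subset_Icc (hus i).1 (hus j).2
  have hterm : ∀ i, edist (f (u (i + 1))) (f (u i))
      ≤ ENNReal.ofReal (∫ x in (u i)..(u (i + 1)), |f' x|) := by
    intro i
    have hi : u i ≤ u (i + 1) := hu (Nat.le_succ i)
    have hsub : Icc (u i) (u (i + 1)) ⊆ Icc a b := Icc_subset_Icc (hus i).1 (hus (i + 1)).2
    rw [edist_dist, Real.dist_eq]
    refine ENNReal.ofReal_le_ofReal ?_
    have hftc : ∫ x in (u i)..(u (i + 1)), f' x = f (u (i + 1)) - f (u i) :=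
      intervalIntegral.integral_eq_sub_of_hasDerivAt_of_le hi (hcont.mono hsub)
        (fun x hx ↦ hderiv x ⟨lt_of_le_of_lt (hus i).1 hx.1, lt_of_lt_of_le hx.2 (hus (i + 1)).2⟩)
        (hint.mono_set (by rw [uIcc_of_le hi, uIcc_of_le hab]; exact hsub))
    rw [← hftc]
    exact intervalIntegral.abs_integral_le_integral_abs hi
  calc ∑ i ∈ Finset.range n, edist (f (u (i + 1))) (f (u i))
      ≤ ∑ i ∈ Finset.range n, ENNReal.ofReal (∫ x in (u i)..(u (i + 1)), |f' x|) :=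
        Finset.sum_le_sum fun i _ ↦ hterm i
    _ = ENNReal.ofReal (∑ i ∈ Finset.range n, ∫ x in (u i)..(u (i + 1)), |f' x|) := by
        rw [ENNReal.ofReal_sum_of_nonneg]
        exact fun i _ ↦ intervalIntegral.integral_nonneg (hu (Nat.le_succ i)) fun _ _ ↦ abs_nonneg _
    _ = ENNReal.ofReal (∫ x in (u 0)..(u n), |f' x|) := by
        rw [intervalIntegral.sum_integral_adjacent_intervals]
        exact fun k _ ↦ hpiece k (k + 1) (Nat.le_succ k)
    _ ≤ ENNReal.ofReal (∫ x in a..b, |f' x|) := by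
        refine ENNReal.ofReal_le_ofReal ?_
        exact intervalIntegral.integral_mono_interval (hus 0).1 (hu (Nat.zero_le n)) (hus n).2
          (Eventually.of_forall fun _ ↦ abs_nonneg _) habs

/-- Real-valued form: `(V_a^b(f)).toReal ≤ ∫_a^b |f′|`. [folklore] -/
theorem toReal_eVariationOn_Icc_le_integral_abs_deriv {f f' : ℝ → ℝ} {a b : ℝ} (hab : a ≤ b)
    (hcont : ContinuousOn f (Icc a b)) (hderiv : ∀ x ∈ Ioo a b, HasDerivAt f (f' x) x)
    (hint : IntervalIntegrable f' volume a b) :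
    (eVariationOn f (Icc a b)).toReal ≤ ∫ x in a..b, |f' x| :=
  ENNReal.toReal_le_of_le_ofReal (intervalIntegral.integral_nonneg hab fun _ _ ↦ abs_nonneg _)
    (eVariationOn_Icc_le_integral_abs_deriv hab hcont hderiv hint)

/-- Sup bound from the end-point value and the derivative: `|f(t)| ≤ |f(b)| + ∫_a^b |f′|` for
`t ∈ [a, b]`. [folklore] -/
theorem abs_le_abs_add_integral_abs_deriv {f f' : ℝ → ℝ} {a b : ℝ} (hab : a ≤ b)
    (hcont : ContinuousOn f (Icc a b)) (hderiv : ∀ x ∈ Ioo a b, HasDerivAt f (f' x) x)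
    (hint : IntervalIntegrable f' volume a b) {t : ℝ} (ht : t ∈ Icc a b) :
    |f t| ≤ |f b| + ∫ x in a..b, |f' x| := by
  have hsub : Icc t b ⊆ Icc a b := Icc_subset_Icc_left ht.1
  have hint' : IntervalIntegrable f' volume t b :=
    hint.mono_set (by rw [uIcc_of_le ht.2, uIcc_of_le hab]; exact hsub)
  have hftc : ∫ x in t..b, f' x = f b - f t :=
    intervalIntegral.integral_eq_sub_of_hasDerivAt_of_le ht.2 (hcont.mono hsub)
      (fun x hx ↦ hderiv x ⟨lt_of_le_of_lt ht.1 hx.1, hx.2⟩) hint'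
  have h1 : |f b - f t| ≤ ∫ x in t..b, |f' x| := by
    rw [← hftc]; exact intervalIntegral.abs_integral_le_integral_abs ht.2
  have h2 : ∫ x in t..b, |f' x| ≤ ∫ x in a..b, |f' x| :=
    intervalIntegral.integral_mono_interval ht.1 ht.2 le_rfl
      (Eventually.of_forall fun _ ↦ abs_nonneg _) hint.abs
  have h3 : |f t| ≤ |f b| + |f b - f t| := by
    have := abs_sub_abs_le_abs_sub (f t) (f b)
    rw [abs_sub_comm] at this
    linarith
  linarith


/-- **The error term of Fact 6.4 in `W^{1,1}` form.**  Combining the uniform bound with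
`V_0^λ(h_λ) ≤ ∫_0^λ |h_λ′|` and `sup_{[0,λ]} |h_λ| ≤ |h_λ(λ)| + ∫_0^λ |h_λ′|`: for `λ ≥ 1`, `0 ≤ α₀ < ½`
and every `s` with `|Re s| ≤ α₀`,

  `‖4M_λ(s) − ξ(½+s)‖ ≤ 4(¼−α₀²)^{-1}·(|h_λ(λ)|λ + ∫_0^λ |h_λ′ − h′|(x)(x^{½−α₀} + x^{½+α₀})dx
        + ∫_λ^∞ |h′(x)|(x^{½−α₀} + x^{½+α₀})dx) + 4(|h_λ(λ)| + 2∫_0^λ |h_λ′|)λ^{−(½−α₀)}/(½−α₀)`,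

with NO hypothesis beyond `h_{0,λ}, h_{4,λ}` being prolate functions in the sense of `IsProlateFunction`
(evenness: `IsProlateFunction.even`; `∫ h_{0,λ} > 0`: `integral_pos_of_isProlateFunction_zero`).  Hence
Fact 6.4 follows from `λ h_λ(λ) → 0` and the (weighted and plain) `L¹` convergence `h_λ′ → h′` on `[0, λ]`
— statements about prolate spheroidal functions that are not proved here. [cite: Connes2026Letter, §6.4
Fact 6.4; ConnesConsaniMoscovici2025, §7] -/
theorem norm_four_mul_prolateGuessMellin_sub_riemannXi_le_W11 {lam : ℝ} {f0 f4 : ℝ → ℝ}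
    (h0 : IsProlateFunction lam 0 f0) (h4 : IsProlateFunction lam 4 f4) (hlam1 : 1 ≤ lam)
    {α₀ : ℝ} (hα : 0 ≤ α₀) (hα' : α₀ < 1 / 2) {s : ℂ} (hs : |s.re| ≤ α₀) :
    ‖4 * prolateGuessMellin lam f0 f4 s - riemannXi (1 / 2 + s)‖ ≤
      4 / (1 / 4 - α₀ ^ 2) *
          (|prolateGuessH lam f0 f4 lam| * lam
            + (∫ x in (0 : ℝ)..lam, |deriv (prolateGuessH lam f0 f4) x - connesHermiteH' x|
                * (x ^ (1 / 2 - α₀) + x ^ (1 / 2 + α₀)))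
            + ∫ x in Ioi lam, |connesHermiteH' x| * (x ^ (1 / 2 - α₀) + x ^ (1 / 2 + α₀)))
        + 4 * ((|prolateGuessH lam f0 f4 lam|
            + 2 * ∫ x in (0 : ℝ)..lam, |deriv (prolateGuessH lam f0 f4) x|)
          * lam ^ (-(1 / 2 - α₀)) / (1 / 2 - α₀)) := by
  have hlam : 0 < lam := h0.lam_pos
  obtain ⟨⟨L, hL⟩, -⟩ := prolateGuessH_lipschitz_support h0 h4
  obtain ⟨hd, hdi⟩ := prolateGuessH_hasDerivAt h0 h4
  set D := ∫ x in (0 : ℝ)..lam, |deriv (prolateGuessH lam f0 f4) x| with hD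
  have hM : ∀ t ∈ Icc 0 lam, |prolateGuessH lam f0 f4 t| ≤ |prolateGuessH lam f0 f4 lam| + D :=
    fun t ht ↦ abs_le_abs_add_integral_abs_deriv hlam.le hL.continuousOn hd hdi ht
  have hV : (eVariationOn (prolateGuessH lam f0 f4) (Icc 0 lam)).toReal ≤ D :=
    toReal_eVariationOn_Icc_le_integral_abs_deriv hlam.le hL.continuousOn hd hdi
  have h := norm_four_mul_prolateGuessMellin_sub_riemannXi_le_uniform_of_even h0 h4 hlam1 hM hα hα' hs
  have hc : 0 ≤ lam ^ (-(1 / 2 - α₀)) / (1 / 2 - α₀) := by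
    have : 0 < 1 / 2 - α₀ := by linarith
    positivity
  have hsum : (eVariationOn (prolateGuessH lam f0 f4) (Icc 0 lam)).toReal
        + (|prolateGuessH lam f0 f4 lam| + D) ≤ |prolateGuessH lam f0 f4 lam| + 2 * D := by
    linarith
  have key : ((eVariationOn (prolateGuessH lam f0 f4) (Icc 0 lam)).toReal
        + (|prolateGuessH lam f0 f4 lam| + D)) * lam ^ (-(1 / 2 - α₀)) / (1 / 2 - α₀)
      ≤ (|prolateGuessH lam f0 f4 lam| + 2 * D) * lam ^ (-(1 / 2 - α₀)) / (1 / 2 - α₀) := by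
    rw [mul_div_assoc, mul_div_assoc]
    exact mul_le_mul_of_nonneg_right hsum hc
  linarith [h, key]

end Literature.NumberTheory.LFunctions
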